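import Literature.Probability.RandomPlanarGeometry.SAWCountMonotoneEven
import Literature.Probability.RandomPlanarGeometry.SAWCountMonotoneEscape
import HarnessLib

/-!
# No walk is trapped at BOTH ends at an even length `n ≤ 8d - 6`: the even half of the both-trapped
# threshold, and the escape residual there consists of pocketed (untrapped) ends only

Sibling of `SAWCountMonotoneEven.lean` (no DOUBLY trapped walk — trapped end, at most ONE free start
site — of even length `n ≤ 8d - 8`: the `2d` cage sites of the end and the `≥ 2d - 1` visited neighbours of
the start all sit at odd times `< n` and share at most two sites).  With a COMPLETELY surrounded start the
same count has `2d + 2d - 2 ≤ n/2`, one step further: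

* `bothTrapped_eq_empty_of_even` : for even `n` with `n + 6 ≤ 8d` no `n`-step self-avoiding walk on `ℤ^d`
  has `extCount ω n = 0` and `extCount (revWalk n ω) n = 0`;
* `one_le_extCount_of_mem_escapeResidual_of_even` : hence at those lengths every walk of the escape
  residual `R` of `SAWCountMonotoneEscape.lean` (doomed end, surrounded start) has an UNTRAPPED, pocketed
  end — the class a pocket lemma must exclude to push O'Brien's inequality to the even `n ≤ 8d - 6` by the
  escape route.

The bound is sharp: `SAWCountMonotoneEscapeSharpEven.lean` has both-trapped walks at every even
`n ≥ 8d - 4`.  Exhaustive enumeration (lane «pcv-sawmu» a-p4 g26, kit j306921 / j307755; not used in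
proofs): on `ℤ²` the pocketed class is empty for `n ≤ 12` (first `16` walks at `n = 13`), on `ℤ³` it is
empty for all `n ≤ 20`.

[cite: MadrasSlade1993, §1.2 p. 10 (parity), §7.1 p. 231] [cite: BDGS2012, §1.3 (`cₙ ≤ cₙ₊₁`, O'Brien 1990)]
-/

noncomputable section

open Literature.Probability.LatticeModels Literature.Probability.Percolation SimpleGraph

namespace Literature.Probability.RandomPlanarGeometry.SAW.Zd

variable {d : ℕ}

open Classical in
/-- **No walk trapped at both ends at an even length `n ≤ 8d - 6`.** If `n` is even and both
`extCount ω n = 0` and `extCount (revWalk n ω) n = 0`, then the `2d` neighbours of the end and the `2d`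
neighbours of the start are visited at odd times `< n` and overlap in at most two sites, so
`4d - 2 ≤ n / 2`. [cite: MadrasSlade1993, §1.2, p. 10; §7.1] [cite: BDGS2012, §1.3] -/
theorem bothTrapped_eq_empty_of_even {n : ℕ} (hev : Even n) (hn : n + 6 ≤ 8 * d) :
    ((saws d n).filter fun ω => extCount ω n = 0 ∧ extCount (revWalk n ω) n = 0) = ∅ := by
  classical
  refine Finset.eq_empty_of_forall_notMem fun ω hωT => ?_
  obtain ⟨hω, h0, h1⟩ := Finset.mem_filter.1 hωT
  obtain ⟨h00, -, -, hinj⟩ := mem_saws.1 hω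
  have hn2 : n % 2 = 0 := Nat.even_iff.1 hev
  have hn7 : 4 * d ≤ n + 1 := four_mul_le_of_extCount_eq_zero hω h0
  have hinj' : ∀ i ≤ n, ∀ j ≤ n, ω i = ω j → i = j := fun i hi j hj h =>
    hinj (show i ∈ {i | i ≤ n} from hi) (show j ∈ {i | i ≤ n} from hj) h
  have h0n : ω n ≠ ω 0 := fun h => by have := hinj' n le_rfl 0 (Nat.zero_le n) h; omega
  -- the sites visited at odd times below `n`
  set O := (Finset.range n).filter fun i => i % 2 = 1 with hO
  set V := O.image ω with hV
  have hVcard : V.card ≤ n / 2 := Finset.card_image_le.trans (card_filter_range_odd_le n)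
  -- `A`: the neighbours of the trapped end, all visited at odd times `< n`
  set A := nbrs (ω n) with hA
  have hAV : A ⊆ V := by
    intro y hy
    have hadj := mem_nbrs.1 hy
    have hvis : ∃ i ≤ n, ω i = y := by
      by_contra h
      have : y ∈ freeNbrs ω n := mem_freeNbrs.2 ⟨hadj, fun i hi hiy => h ⟨i, hi, hiy⟩⟩
      rw [extCount, Finset.card_eq_zero] at h0
      rw [h0] at this
      exact Finset.notMem_empty y this
    obtain ⟨i, hi, rfl⟩ := hvis
    have hin : i ≠ n := fun h => hadj.ne (by rw [h])
    have hpar := odd_add_of_adj_apply hω hi hadj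
    refine Finset.mem_image.2 ⟨i, ?_, rfl⟩
    rw [hO, Finset.mem_filter, Finset.mem_range]
    exact ⟨by omega, by omega⟩
  -- `W`: the visited neighbours of the start — all `2d` of them — at odd times `< n`
  set U := (nbrs (ω 0)).filter fun z => ∀ i ≤ n, ω i ≠ z with hU
  set W := (nbrs (ω 0)).filter fun z => ¬ ∀ i ≤ n, ω i ≠ z with hW
  have hUW : U.card + W.card = 2 * d := by
    rw [hU, hW, Finset.card_filter_add_card_filter_not, card_nbrs]
  have hU0 : U.card ≤ 0 := (card_filter_nbrs_start_le_extCount_revWalk hω).trans h1.le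
  have hWV : W ⊆ V := by
    intro z hz
    rw [hW, Finset.mem_filter] at hz
    obtain ⟨hz, hvis⟩ := hz
    have hadj0 := mem_nbrs.1 hz
    have hex : ∃ i ≤ n, ω i = z := by
      by_contra h; exact hvis fun i hi hiz => h ⟨i, hi, hiz⟩
    obtain ⟨j, hj, rfl⟩ := hex
    have hpar := odd_add_of_adj_apply_apply hω (Nat.zero_le n) hj hadj0
    refine Finset.mem_image.2 ⟨j, ?_, rfl⟩
    rw [hO, Finset.mem_filter, Finset.mem_range]
    exact ⟨by omega, by omega⟩
  -- the overlap: common neighbours of `ω n` and `ω 0`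
  have hAW : (A ∩ W).card ≤ 2 := by
    have hsub : A ∩ W ⊆ (nbrs (ω n)).filter fun z => (zdGraph d).Adj (ω n) z ∧ (zdGraph d).Adj z (ω 0) := by
      intro z hz
      rw [Finset.mem_inter] at hz
      obtain ⟨hzA, hzW⟩ := hz
      rw [hW, Finset.mem_filter] at hzW
      exact Finset.mem_filter.2 ⟨hzA, mem_nbrs.1 hzA, (mem_nbrs.1 hzW.1).symm⟩
    exact (Finset.card_le_card hsub).trans (card_filter_adj_adj_le_two h0n _)
  -- count
  have hunion : (A ∪ W).card ≤ V.card := Finset.card_le_card (Finset.union_subset hAV hWV)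
  have hAcard : A.card = 2 * d := card_nbrs _
  have hIE := Finset.card_union_add_card_inter A W
  omega

/-- **At an even length `n ≤ 8d - 6` every residual walk has a pocketed, untrapped end**: if
`ω ∈ escapeResidual d n` (doomed end, surrounded start) then `extCount ω n ≥ 1`. [cite: BDGS2012, §1.3] -/
theorem one_le_extCount_of_mem_escapeResidual_of_even {n : ℕ} (hev : Even n) (hn : n + 6 ≤ 8 * d)
    {ω : ℕ → Site d} (hω : ω ∈ escapeResidual d n) : 1 ≤ extCount ω n := by
  classical
  obtain ⟨hs, -, hb⟩ := mem_escapeResidual.1 hω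
  by_contra h
  have ha : extCount ω n = 0 := by omega
  have hmem : ω ∈ (saws d n).filter (fun ω => extCount ω n = 0 ∧ extCount (revWalk n ω) n = 0) :=
    Finset.mem_filter.2 ⟨hs, ha, hb⟩
  rw [bothTrapped_eq_empty_of_even hev hn] at hmem
  exact Finset.notMem_empty ω hmem

open Classical in
/-- Reformulation: at an even length `n ≤ 8d - 6` the escape residual is contained in the walks with
an untrapped (but doomed) end and a surrounded start. [cite: BDGS2012, §1.3] -/
theorem escapeResidual_subset_untrapped_of_even {n : ℕ} (hev : Even n) (hn : n + 6 ≤ 8 * d) :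
    escapeResidual d n ⊆ (saws d n).filter fun ω =>
      1 ≤ extCount ω n ∧ ¬ EndFree ω n ∧ extCount (revWalk n ω) n = 0 := by
  classical
  intro ω hω
  obtain ⟨hs, hf, hb⟩ := mem_escapeResidual.1 hω
  exact Finset.mem_filter.2 ⟨hs, one_le_extCount_of_mem_escapeResidual_of_even hev hn hω, hf, hb⟩

end Literature.Probability.RandomPlanarGeometry.SAW.Zd
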